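import Summits.Ventures.GridStability.Models.InverterPLLDuI04Roa
import Summits.Ventures.GridStability.Bench.PLLSWINGDeg4ADuI04K32WideBall
import HarnessLib

/-!
# G3.d «PLL-swing» deg-4 — rider «PLLSWING-DEG4 BALL» (model half): a ball of PLL STATES `(θ, ω)` around the locked operating point
# inside the degree-4 certified region, with the basin sentence from it (hypothesis-free on the instance of record «PLLSWING-Du-I04»)

Venture GRIDFUSION, cell `gridfusion`; seat gridfusion-lyap-2 (g4); LOW rider (pattern of «#62′ WSCC9-DEG4-BALL» p544490). Sibling
of `PLLSWINGDeg4ADuI04K32WideBall.lean` (recast half: `σ² + κ² + ω² ≤ (171/250)²` ∩ {h = 0} ⊆ {V₄ ≤ 41}, ONE `decide` on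
`Lyapunov/PolyRecastBox`) and of model-3's `Models/InverterPLLDuI04Roa.lean` (`GenSwing.duI04.deg4_A_k32_wide_roa`: the certified
basin read on the PLL generalized swing equation, hypothesis-free, window `|θ₀ − θ^s| < π`; composition of lyap-1's recast -roa
`Bench/PLLSWINGDeg4ADuI04K32WideRoa.lean` with model-3's transport `Models/InverterPLLRoa.lean` p476750), which it imports;
embedding vocabulary = model-1's `SMIB.embed θ^s (θ, ω) = (sin u, 1 − cos u, ω)`, `u = θ − θ^s`, and model-3's
`duI04.deg4_A_k32_wide_embed_mem_M`. New facts: `sin²u + (1 − cos u)² ≤ u²` and the packaging; the window hypothesis is discharged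
by the ball (`u₀² ≤ s² < 1 < π²`).

STATEMENT (`deg4_A_DuI04_k32_wide_pll_roa_ball`): for every solution `(θ, ω)` of `GenSwing.duI04` (`θ̇ = ω`, `ω̇ = I′ − sin θ − (α
cos θ − D) ω`, `(I′, D, α) = (63365/158413, 39/100, 7/10)`, derivatives at all times) whose INITIAL PLL STATE satisfies `(θ(0) −
θ^s)² + ω(0)² ≤ (171/250)²` (`θ^s = arcsin(63365/158413)`; renderings of `s = 171/250`, VALIDATED column only: phase mismatch ≤
39.2° at `ω = 0`, or `|ω(0)| ≤ 0.684` at the locked angle): `V₄ ≤ 41` along the recast state and `|θ t − θ^s| < π` for all `t ≥ 0`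
(no loss of lock), `θ t → θ^s` and `ω t → 0`; `deg4_A_DuI04_k32_wide_pll_basin_ball` keeps the last three conclusions only.

THREE COLUMNS. CERTIFIED (kernel): the inclusion of the ball in the certified piece (recast half) + this packaging. MODELLED: as the
parent row G3.d (M′ = PLL generalized swing equation [DuEtAl2024, Eq. (1)] at «PLLSWING-Du-I04»; MODEL-VALIDITY MV-6P(GenSwing) +
MV-P(I′ = s*): grid-following converter, SRF-PLL reduced model, current loops algebraic, PLL filter / limiters / LVRT logic ABSENT;
the dimensionless groups `(I′, D, α)` are the object). VALIDATED: nothing here (yardsticks: the printed basin of [DuEtAl2024, Fig.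
1(a)], sos-1's RK4 scan j261949 — never the claim) and the renderings of `s`. No sentence here says a converter or a grid is stable;
the ball is a set of initial states OF THE MODEL M′ inside a CERTIFICATE's sublevel piece (a crude coefficient-majorant inner
description of it), carried to the locked operating point of M′ without loss of lock — never «the basin of the system».
-/

namespace Summit.Ventures.GridStability.Bench.PLLSWING

open Set Filter Metric Topology Real
open Summit.Ventures.GridStability.Lyapunov Summit.Ventures.GridStability.Models
open Summit.Ventures.GridStability.Models.InverterPLL.GenSwing
open Literature.Computation.Certificates Literature.Computation.Certificates.SOS

noncomputable section

/-- `sin²u + (1 − cos u)² = 2 − 2cos u ≤ u²` (from `1 − u²/2 ≤ cos u`). [folklore] -/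
private theorem sin_sq_add_one_sub_cos_sq_le' (u : ℝ) : sin u ^ 2 + (1 - cos u) ^ 2 ≤ u ^ 2 := by
  nlinarith [sin_sq_add_cos_sq u, Real.one_sub_sq_div_two_le_cos (x := u)]

/-- **The PLL-state ball lies in the certified piece**: `(θ − θ^s)² + ω² ≤ (171/250)²` ⇒ `V₄(sin u, 1 − cos u, ω) ≤ 41`
(`u = θ − θ^s`). [folklore] -/
theorem deg4_A_DuI04_k32_wide_V_embed_le_level_of_ball (y : ℝ × ℝ)
    (hball : (y.1 - duI04_θs) ^ 2 + y.2 ^ 2 ≤ (171 / 250 : ℝ) ^ 2) :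
    deg4_A_DuI04_k32_wide_V (sin (y.1 - duI04_θs)) (1 - cos (y.1 - duI04_θs)) y.2 ≤ deg4_A_DuI04_k32_wide_level := by
  have hM := duI04.deg4_A_k32_wide_embed_mem_M y
  have hh : deg4_A_DuI04_k32_wide_h (sin (y.1 - duI04_θs)) (1 - cos (y.1 - duI04_θs)) y.2 = 0 := by
    simpa [deg4_A_DuI04_k32_wide_M] using hM
  have hZ := sin_sq_add_one_sub_cos_sq_le' (y.1 - duI04_θs)
  show deg4_A_DuI04_k32_wide_V (sin (y.1 - duI04_θs)) (1 - cos (y.1 - duI04_θs)) y.2 ≤ 41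
  exact deg4_A_DuI04_k32_wide_V_le_level_of_ball _ _ _ hh (by linarith)

/-- The ball discharges the window hypothesis: `(θ − θ^s)² + ω² ≤ (171/250)² < 1` ⇒ `|θ − θ^s| < π`. [folklore] -/
theorem deg4_A_DuI04_k32_wide_abs_lt_pi_of_ball (y : ℝ × ℝ)
    (hball : (y.1 - duI04_θs) ^ 2 + y.2 ^ 2 ≤ (171 / 250 : ℝ) ^ 2) : |y.1 - duI04_θs| < π := by
  have hsq : (y.1 - duI04_θs) ^ 2 ≤ 1 := by nlinarith [sq_nonneg y.2]
  have h1 := (sq_le_one_iff_abs_le_one _).1 hsq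
  linarith [Real.pi_gt_three]

/-- **«PLLSWING-DEG4 BALL» — the basin sentence from a ball of PLL states (instance «PLLSWING-Du-I04», hypothesis-free).** For every
solution `(θ, ω)` of `GenSwing.duI04` with `(θ(0) − θ^s)² + ω(0)² ≤ (171/250)²`: for all `t ≥ 0`, `V₄ ≤ 41` along the recast state and
`|θ t − θ^s| < π` (no loss of lock), and `θ t → θ^s`, `ω t → 0`. MODELLED/CERTIFIED columns as in the module docstring. [folklore] -/
theorem deg4_A_DuI04_k32_wide_pll_roa_ball {θ ω : ℝ → ℝ} (h : duI04.IsSolution θ ω)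
    (hball : (θ 0 - duI04_θs) ^ 2 + ω 0 ^ 2 ≤ (171 / 250 : ℝ) ^ 2) :
    (∀ t, 0 ≤ t →
        deg4_A_DuI04_k32_wide_V (sin (θ t - duI04_θs)) (1 - cos (θ t - duI04_θs)) (ω t) ≤ deg4_A_DuI04_k32_wide_level ∧
          |θ t - duI04_θs| < π) ∧
      Tendsto θ atTop (𝓝 duI04_θs) ∧ Tendsto ω atTop (𝓝 0) := by
  have hl : (0 : ℝ) < deg4_A_DuI04_k32_wide_level := by
    unfold deg4_A_DuI04_k32_wide_level; norm_num
  exact duI04.deg4_A_k32_wide_roa hl le_rfl h (deg4_A_DuI04_k32_wide_V_embed_le_level_of_ball (θ 0, ω 0) hball)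
    (deg4_A_DuI04_k32_wide_abs_lt_pi_of_ball (θ 0, ω 0) hball)

/-- The same ball as a set of initial PLL states OF THE MODEL carried to the locked operating point without loss of lock:
`(θ₀ − θ^s)² + ω₀² ≤ (171/250)²` ⇒ `|θ t − θ^s| < π` for all `t ≥ 0`, `θ t → θ^s`, `ω t → 0`. [folklore] -/
theorem deg4_A_DuI04_k32_wide_pll_basin_ball {θ ω : ℝ → ℝ} (h : duI04.IsSolution θ ω)
    (hball : (θ 0 - duI04_θs) ^ 2 + ω 0 ^ 2 ≤ (171 / 250 : ℝ) ^ 2) :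
    (∀ t, 0 ≤ t → |θ t - duI04_θs| < π) ∧ Tendsto θ atTop (𝓝 duI04_θs) ∧ Tendsto ω atTop (𝓝 0) := by
  obtain ⟨hinv, hθ, hω⟩ := deg4_A_DuI04_k32_wide_pll_roa_ball h hball
  exact ⟨fun t ht => (hinv t ht).2, hθ, hω⟩

end

end Summit.Ventures.GridStability.Bench.PLLSWING
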